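import Literature.AlgebraicGeometry.Resolution.BlowupDimension
import Literature.AlgebraicGeometry.Resolution.RegularBlowup
import Literature.AlgebraicGeometry.Resolution.MonomialOrderReductionUnit
import HarnessLib

/-!
# Cossart–Piltant sequences of blowing ups keep integrality and do not raise the dimension

Topic: `Literature/AlgebraicGeometry/Resolution`. Bookkeeping for the sequences
`𝒮 = 𝒮(0) ← 𝒮(1) ← ⋯ ← 𝒮(r)` of Cossart–Piltant 2019, Prop. 4.4 / [CoP1] Prop. 4.2
(`IsRegularCentreBlowupSeq σ J`, `Principalization.lean`): when `J ≠ 0` and `𝒮` is integral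
and locally Noetherian, every stage is integral, the transform `J𝒪` stays non-zero (each centre,
lying in the non-locally-principal locus of a non-zero ideal sheaf, is a proper closed subset,
and a blowing up is an isomorphism over the complement of its centre), and — by
`BlowupDimension.lean` (Matsumura Thm. 15.5) — `dim 𝒮(i) ≤ dim 𝒮`. PROVED:

* `IsBlowup.comap_ne_bot` — the inverse image of a non-zero ideal sheaf under a blowing up of
  an integral scheme along a centre `≠ X` is non-zero;
* `IsRegularCentreBlowupSeq.isIntegral_and_comap_ne_bot`, `IsRegularCentreBlowupSeq.isIntegral`,
  `IsRegularCentreBlowupSeq.isNoetherian`;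
* `IsRegularCentreBlowupSeq.topologicalKrullDim_le`, `IsRegularCentreBlowupSeq.coheight_le` —
  `dim 𝒮 ≤ n ⟹ dim 𝒮(i) ≤ n` and `codim x ≤ n` at every point of every stage.

## Sources

* V. Cossart, O. Piltant, J. Algebra 529 (2019), Prop. 4.4 (arXiv v1: Prop. 4.3); J. Algebra
  320 (2008), Prop. 4.2. [CossartPiltant2019] [CossartPiltant2008]
* H. Matsumura, *Commutative Ring Theory*, Thm. 15.5. [Matsumura1987]
-/

noncomputable section

open CategoryTheory CategoryTheory.Limits AlgebraicGeometry TopologicalSpace IsLocalRing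

namespace Literature.AlgebraicGeometry.Resolution

universe u

open Scheme.IdealSheafData

variable {X X' : Scheme.{u}} {π : X' ⟶ X}

/-- **The transform of a non-zero ideal sheaf under a blowing up is non-zero**: for a blowing up
`π : X' → X` of an integral scheme along `C` with `V(C) ≠ X` and `K ≠ 0`, `K𝒪_{X'} ≠ 0` — over
the dense open `X ∖ V(C)` the blowing up is an isomorphism, and the generic point of `X`, off
`V(K)`, has a preimage there, off `V(K𝒪_{X'})`. [cite: StacksProject, Tag 02OS] -/
theorem IsBlowup.comap_ne_bot [IsIntegral X] {C : X.IdealSheafData}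
    (hπ : IsBlowup π C) (hC : C.support ≠ ⊤) {K : X.IdealSheafData} (hK : K ≠ ⊥) :
    K.comap π ≠ ⊥ := by
  -- the generic point `ξ` of `X` is off `V(C)` and off `V(K)`
  have hξC : genericPoint X ∉ C.support := fun h => hC (by
    rw [eq_top_iff]
    intro x _
    exact ((genericPoint_spec X).mem_closed_set_iff C.support.isClosed).mp h (Set.mem_univ x))
  have hξK : genericPoint X ∉ K.support := not_mem_support_genericPoint hK
  -- a preimage `ξ'` of `ξ` (the blowing up is an isomorphism over `X ∖ V(C)`)
  set W₀ : X.Opens := ⟨(C.support : Set X)ᶜ, C.support.isClosed.isOpen_compl⟩ with hW₀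
  haveI : IsIso (π ∣_ W₀) := hπ.isIso_compl
  obtain ⟨ξ', hξ'⟩ := (ConcreteCategory.bijective_of_isIso ((π ∣_ W₀).base)).2 ⟨genericPoint X, hξC⟩
  have hπξ' : π ξ'.1 = genericPoint X := by
    have := congrArg Subtype.val hξ'
    rwa [morphismRestrict_base_coe] at this
  -- `(K𝒪)_{ξ'} = K_ξ 𝒪 = 𝒪`
  intro hbot
  have hmem : ξ'.1 ∈ (K.comap π).support := by rw [hbot, Scheme.IdealSheafData.support_bot]; trivial
  rw [Scheme.IdealSheafData.support_comap] at hmem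
  exact hξK (hπξ' ▸ hmem)

/-- **Along a Cossart–Piltant sequence for `J ≠ 0` over an integral locally Noetherian scheme,
every stage is integral and locally Noetherian and `J𝒪 ≠ 0`**: each centre lies in the
non-locally-principal locus of the non-zero `J𝒪`, a proper closed subset
(`nonPrincipalLocus_ne_top`), so the blowing up is again integral (`IsBlowup.isIntegral`) and
`J𝒪` stays non-zero (`IsBlowup.comap_ne_bot`).
[cite: CossartPiltant2019, Prop. 4.4 (arXiv v1: Prop. 4.3)] -/
theorem IsRegularCentreBlowupSeq.isIntegral_and_comap_ne_bot :
    ∀ {S' S : Scheme.{u}} {σ : S' ⟶ S} {J : S.IdealSheafData}, IsRegularCentreBlowupSeq σ J →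
      IsIntegral S → IsLocallyNoetherian S → J ≠ ⊥ →
      IsIntegral S' ∧ IsLocallyNoetherian S' ∧ J.comap σ ≠ ⊥ := by
  intro S' S σ J h
  induction h with
  | nil J =>
    intro hint hN hJ
    exact ⟨hint, hN, by rwa [Scheme.IdealSheafData.comap_id]⟩
  | @cons S'' S' S τ σ J Y hσ hYint hYreg hY hτ ih =>
    intro hint hN hJ
    obtain ⟨hint', hN', hJ'⟩ := ih hint hN hJ
    haveI := hint'
    haveI := hN'
    haveI : IsProper τ := hτ.isProper
    -- the centre is a proper closed subset
    have hYtop : (vanishingIdeal Y).support ≠ ⊤ := by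
      intro htop
      apply nonPrincipalLocus_ne_top hJ'
      rw [eq_top_iff]
      intro y _
      have hy : y ∈ (Y : Set S') := by
        rw [← coe_support_vanishingIdeal Y, htop]
        trivial
      exact hY y hy
    have hY0 : vanishingIdeal Y ≠ ⊥ := fun h => hYtop (by rw [h, Scheme.IdealSheafData.support_bot])
    refine ⟨hτ.isIntegral hY0, LocallyOfFiniteType.isLocallyNoetherian τ, ?_⟩
    rw [Scheme.IdealSheafData.comap_comp]
    exact hτ.comap_ne_bot hYtop hJ'

/-- In particular every stage is integral. [cite: CossartPiltant2019, Prop. 4.4 (arXiv v1: Prop. 4.3)] -/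
theorem IsRegularCentreBlowupSeq.isIntegral {S' S : Scheme.{u}} {σ : S' ⟶ S}
    {J : S.IdealSheafData} (h : IsRegularCentreBlowupSeq σ J) [IsIntegral S]
    [IsLocallyNoetherian S] (hJ : J ≠ ⊥) : IsIntegral S' :=
  (h.isIntegral_and_comap_ne_bot inferInstance inferInstance hJ).1

/-- The stages of a Cossart–Piltant sequence over a Noetherian scheme are Noetherian (blowing
ups are proper: locally of finite type and quasi-compact). [cite: StacksProject, Tag 02NS] -/
theorem IsRegularCentreBlowupSeq.isNoetherian :
    ∀ {S' S : Scheme.{u}} {σ : S' ⟶ S} {J : S.IdealSheafData}, IsRegularCentreBlowupSeq σ J →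
      IsNoetherian S → IsNoetherian S' := by
  intro S' S σ J h
  induction h with
  | nil J => exact id
  | @cons S'' S' S τ σ J Y hσ hYint hYreg hY hτ ih =>
    intro hN
    haveI := ih hN
    haveI : IsProper τ := hτ.isProper
    haveI : IsLocallyNoetherian S'' := LocallyOfFiniteType.isLocallyNoetherian τ
    haveI : CompactSpace S'' := QuasiCompact.compactSpace_of_compactSpace τ
    exact {}

/-- **The stages of a Cossart–Piltant sequence have dimension `≤ dim 𝒮`**: `dim 𝒮 ≤ n` implies
`dim 𝒮(i) ≤ n` (`IsBlowup.topologicalKrullDim_le`, Matsumura Thm. 15.5, stage by stage; the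
schemes `X(i)` of [CoP1] §4 over a threefold are at most three-dimensional).
[cite: Matsumura1987, Thm. 15.5] -/
theorem IsRegularCentreBlowupSeq.topologicalKrullDim_le :
    ∀ {S' S : Scheme.{u}} {σ : S' ⟶ S} {J : S.IdealSheafData}, IsRegularCentreBlowupSeq σ J →
      IsIntegral S → IsLocallyNoetherian S → J ≠ ⊥ → ∀ {n : ℕ},
      topologicalKrullDim S ≤ n → topologicalKrullDim S' ≤ n := by
  intro S' S σ J h
  induction h with
  | nil J => exact fun _ _ _ _ h => h
  | @cons S'' S' S τ σ J Y hσ hYint hYreg hY hτ ih =>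
    intro hint hN hJ n hdim
    obtain ⟨hint', hN', -⟩ := hσ.isIntegral_and_comap_ne_bot hint hN hJ
    haveI := hint'
    haveI := hN'
    exact hτ.topologicalKrullDim_le (ih hint hN hJ hdim)

/-- Hence all local rings of the stages have dimension `≤ dim 𝒮`: `dim 𝒮 ≤ n ⟹ codim x ≤ n`
for every point `x` of every stage. [cite: Matsumura1987, Thm. 15.5] -/
theorem IsRegularCentreBlowupSeq.coheight_le {S' S : Scheme.{u}} {σ : S' ⟶ S}
    {J : S.IdealSheafData} (h : IsRegularCentreBlowupSeq σ J) [IsIntegral S]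
    [IsLocallyNoetherian S] (hJ : J ≠ ⊥) {n : ℕ} (hdim : topologicalKrullDim S ≤ n) (x : S') :
    Order.coheight x ≤ n :=
  (topologicalKrullDim_le_iff_forall_coheight_le S' n).mp
    (h.topologicalKrullDim_le inferInstance inferInstance hJ hdim) x

end Literature.AlgebraicGeometry.Resolution

end
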